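import Literature.AlgebraicGeometry.HodgeTheory.PermutationSymmetry
import HarnessLib

/-!
# Serre 1964, no. 2: `ℤ/p` acts freely on the Fermat hypersurface `Σ xᵢᵖ = 0 ⊂ ℙ^{p-1}` (proved)

J.-P. Serre, *Exemples de variétés projectives conjuguées non homéomorphes*, C. R. Acad. Sci.
Paris 258 (1964) 4194–4196 (= *Œuvres* II no. 63), no. 2: "Dans l'espace projectif de dimension
`p - 1`, soit `Y` l'hypersurface d'équation homogène `Σ_{i=1}^{p} Xᵢᵖ = 0`; c'est une variété non
singulière; sur le corps `ℂ`, c'est un espace simplement connexe, en vertu d'un théorème de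
Lefschetz. Soit `G` le groupe cyclique d'ordre `p`, et faisons opérer `G` sur `Y` par permutation
circulaire des coordonnées; la variété quotient `X = Y/G` est non singulière, puisque `G` opère
librement."

On the tree's carriers — the Fermat hypersurface `X_F = Motives.SmoothHypersurface.hypersurface F`,
`F = Motives.fermatPolynomial ℂ n m = Σ xᵢᵐ` in `n + 2` homogeneous coordinates, and the coordinate
permutations acting on its complex points by `HodgeTheory.permMap` (`[z] ↦ [z ∘ π]`,
`PermutationSymmetry.lean`) — this file PROVES the freeness assertion:

* `permMap_finRotate_pow_ne` — **"`G` opère librement"**: if the number of coordinates `n + 2`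
  is a prime `p` dividing the degree `m` (Serre: `m = p`), then for every `j` not divisible by
  `p` the `j`-th power of the cyclic shift of the coordinates has NO fixed complex point on
  `X_F`.  (A fixed point `[z] = [z ∘ σʲ]` gives `z ∘ σʲ = a z`, `a ∈ ℂˣ`; as `σʲ` is a `p`-cycle,
  `aᵖ = 1` and, from a coordinate `z_{i₀} ≠ 0`, `0 = Σ zᵢᵐ = z_{i₀}ᵐ Σ_r (aᵐ)ʳ = p·z_{i₀}ᵐ`
  since `p ∣ m` — absurd.  The divisibility `p ∣ m` is necessary: for `p ∤ m` the points
  `[1 : ζ : ζ² : …]`, `ζᵖ = 1 ≠ ζᵐ`, are fixed.)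

This is the hypothesis "`hfree`" on the factor `Y` of the lattice models in
`ConjugateVarietiesSerreTwentyThreeProofs.serre1964_twentyThree_of_latticeModels` (`p = 23`).
Proofs only; no definitions, no named facts.  Not here: the simple connectivity of `X_F(ℂ)`
(Lefschetz) and the quotient `Y/G`.

## References

* [Serre1964Conjugate] J.-P. Serre, C. R. Acad. Sci. Paris 258 (1964) 4194–4196, no. 2 (p. 4195).
* [Shioda1979HodgeFermat] T. Shioda, Math. Ann. 245 (1979), §1 (the symmetries of `Xⁿₘ`).
-/

noncomputable section

open CategoryTheory AlgebraicGeometry MvPolynomial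
open scoped LinearAlgebra.Projectivization

namespace Literature.Barriers.HodgeConjecture.Serre1964

open Literature.AlgebraicGeometry.Motives Literature.AlgebraicGeometry.HodgeTheory

open Fin.CommRing in
/-- Powers of the cyclic shift of `Fin (n + 2)`: `σʳ i = i + r`. [folklore] -/
theorem finRotate_pow_apply {n : ℕ} (r : ℕ) (i : Fin (n + 2)) :
    (finRotate (n + 2) ^ r) i = i + (r : Fin (n + 2)) := by
  induction r with
  | zero => simp
  | succ r ih =>
    rw [pow_succ', Equiv.Perm.mul_apply, ih, finRotate_apply, Nat.cast_succ, add_assoc]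

open Fin.CommRing in
/-- In `Fin p`, `p` prime, a natural number not divisible by `p` is a unit. [folklore] -/
theorem isUnit_natCast_fin_of_not_dvd {n : ℕ} (hp : (n + 2).Prime) {j : ℕ} (hj : ¬ n + 2 ∣ j) :
    IsUnit (j : Fin (n + 2)) := by
  have hcop : Nat.Coprime j (n + 2) := (Nat.Prime.coprime_iff_not_dvd hp).2 hj |>.symm
  obtain ⟨c, -, hc⟩ := Nat.exists_mul_mod_eq_one_of_coprime hcop hp.one_lt
  refine IsUnit.of_mul_eq_one (c : Fin (n + 2)) ?_
  apply Fin.ext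
  rw [← Nat.cast_mul, Fin.val_natCast, hc, Fin.val_one]

/-- The value of the Fermat form: `F(z) = Σ zᵢᵐ`. [folklore] -/
theorem eval_fermatPolynomial {n : ℕ} (m : ℕ) (z : Fin (n + 2) → ℂ) :
    eval z (fermatPolynomial ℂ n m) = ∑ i, z i ^ m := by
  simp [fermatPolynomial, map_sum]

open Fin.CommRing in
/-- **Serre 1964, no. 2: "`G` opère librement".** On the Fermat hypersurface
`Σ_{i < p} xᵢᵐ = 0 ⊂ ℙ^{p-1}_ℂ` with `p = n + 2` prime and `p ∣ m` (Serre: `m = p`), no non-trivial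
power `σʲ` (`p ∤ j`) of the cyclic shift `σ` of the coordinates has a fixed complex point.
[cite: Serre1964Conjugate, no. 2 (p. 4195)] -/
theorem permMap_finRotate_pow_ne {n : ℕ} (hp : (n + 2).Prime) {m : ℕ} (hm : n + 2 ∣ m) {j : ℕ}
    (hj : ¬ n + 2 ∣ j)
    (x : ComplexPoints (SmoothHypersurface.hypersurface (fermatPolynomial ℂ n m))) :
    permMap (fermatPolynomial ℂ n m)
      (mem_permStabilizer_fermatPolynomial m (finRotate (n + 2) ^ j)) x ≠ x := by
  intro hfix
  set P := hypersurfacePoint (SmoothHypersurface.hypersurfaceι (fermatPolynomial ℂ n m)) x with hP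
  set z : Fin (n + 2) → ℂ := P.rep with hz
  have hz0 : z ≠ 0 := Projectivization.rep_nonzero P
  -- `F(z) = 0`
  have hFz : ∑ i, z i ^ m = 0 := by
    have hmem : P ∈ Projectivization.projZeroLocus {fermatPolynomial ℂ n m} :=
      hypersurfacePoint_mem_projZeroLocus (isHomogeneous_fermatPolynomial n m)
        (SmoothHypersurface.range_hypersurfaceι _) x
    rw [← eval_fermatPolynomial m z]
    exact hmem _ rfl
  -- a fixed point: `z ∘ σʲ = a • z`
  have hpt := hypersurfacePoint_permMap (fermatPolynomial ℂ n m)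
    (mem_permStabilizer_fermatPolynomial m (finRotate (n + 2) ^ j)) x
  rw [hfix, ← hP] at hpt
  conv_lhs at hpt => rw [← Projectivization.mk_rep P]
  obtain ⟨a, ha⟩ := (Projectivization.mk_eq_mk_iff ℂ _ _ hz0 _).1 hpt
  -- `ha : a • (z ∘ σʲ) = z`
  set J : Fin (n + 2) := (j : Fin (n + 2)) with hJ
  have hstep : ∀ i, (a : ℂ) * z (i + J) = z i := fun i ↦ by
    have := congrFun ha i
    simpa only [Pi.smul_apply, Function.comp_apply, finRotate_pow_apply, Units.smul_def,
      smul_eq_mul] using this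
  have hiter : ∀ (r : ℕ) (i), (a : ℂ) ^ r * z (i + r * J) = z i := by
    intro r
    induction r with
    | zero => intro i; simp
    | succ r ih =>
      intro i
      have h1 := hstep (i + r * J)
      rw [show i + ↑r * J + J = i + ↑(r + 1) * J by push_cast; ring] at h1
      rw [pow_succ, mul_assoc, h1, ih]
  -- a coordinate `z i₀ ≠ 0`
  obtain ⟨i₀, hi₀⟩ : ∃ i, z i ≠ 0 := by
    by_contra h
    push Not at h
    exact hz0 (funext h)
  -- `aᵖ = 1`, hence `aᵐ = 1`
  have hap : (a : ℂ) ^ (n + 2) = 1 := by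
    have h := hiter (n + 2) i₀
    rw [Fin.natCast_self, zero_mul, add_zero] at h
    exact (mul_eq_right₀ hi₀).1 h
  have ham : (a : ℂ) ^ m = 1 := by
    obtain ⟨q, rfl⟩ := hm
    rw [pow_mul, hap, one_pow]
  -- reindex the sum along the orbit of `i₀`
  have hinj : Function.Injective fun r : Fin (n + 2) ↦ i₀ + r * J := fun r r' h ↦
    (isUnit_natCast_fin_of_not_dvd hp hj).mul_left_injective (add_left_cancel h)
  let e : Fin (n + 2) ≃ Fin (n + 2) := Equiv.ofBijective _ hinj.bijective_of_finite
  have hsum : ∑ i, z i ^ m = ∑ r : Fin (n + 2), z (i₀ + r * J) ^ m := (Equiv.sum_comp e _).symm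
  have hterm : ∀ r : Fin (n + 2), z (i₀ + r * J) ^ m = z i₀ ^ m := fun r ↦ by
    have h := hiter r.val i₀
    rw [Fin.cast_val_eq_self] at h
    have hzr : z (i₀ + r * J) = ((a : ℂ) ^ r.val)⁻¹ * z i₀ := by
      rw [← h, ← mul_assoc, inv_mul_cancel₀ (pow_ne_zero _ a.ne_zero), one_mul]
    rw [hzr, mul_pow, inv_pow, ← pow_mul, mul_comm r.val m, pow_mul, ham, one_pow, inv_one,
      one_mul]
  rw [hsum, Finset.sum_congr rfl fun r _ ↦ hterm r, Finset.sum_const, Finset.card_univ,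
    Fintype.card_fin, nsmul_eq_mul] at hFz
  have hne : ((n + 2 : ℕ) : ℂ) ≠ 0 := by exact_mod_cast hp.ne_zero
  exact (mul_ne_zero hne (pow_ne_zero m hi₀)) hFz

/-- The same for the generator itself: the cyclic shift of the coordinates has no fixed complex
point on `Σ_{i < p} xᵢᵐ = 0`, `p = n + 2` prime, `p ∣ m`. [cite: Serre1964Conjugate, no. 2 (p. 4195)] -/
theorem permMap_finRotate_ne {n : ℕ} (hp : (n + 2).Prime) {m : ℕ} (hm : n + 2 ∣ m)
    (x : ComplexPoints (SmoothHypersurface.hypersurface (fermatPolynomial ℂ n m))) :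
    permMap (fermatPolynomial ℂ n m)
      (mem_permStabilizer_fermatPolynomial m (finRotate (n + 2))) x ≠ x := by
  have h := permMap_finRotate_pow_ne hp hm (j := 1)
    (fun h ↦ hp.one_lt.ne' (Nat.dvd_one.1 h)) x
  simpa only [pow_one] using h

end Literature.Barriers.HodgeConjecture.Serre1964

end
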